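import Mathlib
import Literature.AlgebraicGeometry.Resolution.OrderSemicontinuityPointwise
import Literature.AlgebraicGeometry.Resolution.NearPointsLocus
import HarnessLib

/-!
# An isolated point of `Σ = {ord ≥ μ}`: no generization, no non-maximal prime of order `≥ μ`

Topic: `Literature/AlgebraicGeometry/Resolution`. Translation of the isolation hypothesis in the
termination proof of Cossart–Piltant 2008, Prop. 4.4 (p. 11: "a contradiction, since
`{x_{σ(i₁)}}` is an isolated point of `Σ(X_{σ(i₁)})`") into the ring-theoretic form consumed by
`NearChainTermination.false_of_nearChain_tau_two`: if no proper generization `ζ ⤳ x`, `ζ ≠ x`,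
has `ord_ζ J ≥ μ`, then no non-maximal prime `𝔮` of `𝒪_{X,x}` has `J_x 𝒪_𝔮 ⊆ (𝔮 𝒪_𝔮)^μ`
(`not_map_le_pow_of_isolated`): the primes of `𝒪_{X,x}` are the generizations of `x`
(Stacks 01J7, `exists_specializes_comap_stalkSpecializes_eq`), `𝒪_{X,ζ}` is the localization
of `𝒪_{X,x}` at the corresponding prime and `J_ζ = J_x 𝒪_{X,ζ}` (`stalkIdeal_map_stalkSpecializes`).

## Sources

* V. Cossart, O. Piltant, J. Algebra 320 (2008), proof of Prop. 4.4, p. 11. [CossartPiltant2008]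
* The Stacks Project, Tag 01J7. [StacksProject]
-/

noncomputable section

open CategoryTheory AlgebraicGeometry TopologicalSpace IsLocalRing

namespace Literature.AlgebraicGeometry.Resolution

universe u

variable {X : Scheme.{u}}

/-- The prime of `𝒪_{X,x}` corresponding to the trivial generization `x ⤳ x` is `𝔪_x`. [folklore] -/
theorem comap_stalkSpecializes_refl_maximalIdeal (x : X) :
    (maximalIdeal (X.presheaf.stalk x)).comap (X.presheaf.stalkSpecializes (specializes_refl x)).hom =
      maximalIdeal (X.presheaf.stalk x) := by
  have : X.presheaf.stalkSpecializes (specializes_refl x) = 𝟙 _ := by simp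
  rw [this, CommRingCat.hom_id, Ideal.comap_id]

/-- **An isolated point of `Σ = {ord ≥ μ}` in ring-theoretic terms**: if no generization
`ζ ≠ x` of `x` has `ord_ζ J ≥ μ`, then for every non-maximal prime `𝔮 ⊂ 𝒪_{X,x}` the ideal
`J_x 𝒪_𝔮` is not contained in `(𝔮𝒪_𝔮)^μ`. [cite: CossartPiltant2008, proof of Prop. 4.4, p. 11]
[cite: StacksProject, Tag 01J7] -/
theorem not_map_le_pow_of_isolated (J : X.IdealSheafData) (x : X) (μ : ℕ)
    (hisol : ∀ ζ : X, ζ ⤳ x → ζ ≠ x → ¬ ((μ : ℕ∞) ≤ idealOrder J ζ))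
    (𝔮 : Ideal (X.presheaf.stalk x)) [𝔮.IsPrime] (h𝔮 : 𝔮 ≠ maximalIdeal _) :
    ¬ (stalkIdeal J x).map (algebraMap _ (Localization.AtPrime 𝔮)) ≤
      maximalIdeal (Localization.AtPrime 𝔮) ^ μ := by
  intro hle
  -- the generization `ζ` of `x` corresponding to `𝔮`
  obtain ⟨ζ, hζx, hP⟩ := exists_specializes_comap_stalkSpecializes_eq x 𝔮
  have hζne : ζ ≠ x := by
    rintro rfl
    exact h𝔮 (hP.trans (comap_stalkSpecializes_refl_maximalIdeal ζ))
  refine hisol ζ hζx hζne ?_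
  rw [le_idealOrder_iff]
  -- `𝒪_{X,ζ}` is the localization of `𝒪_{X,x}` at `𝔮`
  letI := (X.presheaf.stalkSpecializes hζx).hom.toAlgebra
  haveI hloc := isLocalizationAtPrime_stalkSpecializes hζx
  subst hP
  let e : Localization.AtPrime ((maximalIdeal (X.presheaf.stalk ζ)).comap
      (X.presheaf.stalkSpecializes hζx).hom) ≃ₐ[X.presheaf.stalk x] X.presheaf.stalk ζ :=
    IsLocalization.algEquiv
      ((maximalIdeal (X.presheaf.stalk ζ)).comap (X.presheaf.stalkSpecializes hζx).hom).primeCompl _ _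
  have hmap : (stalkIdeal J x).map (algebraMap _ (X.presheaf.stalk ζ)) = stalkIdeal J ζ :=
    stalkIdeal_map_stalkSpecializes J hζx
  have h1 := (map_le_pow_maximalIdeal_iff_of_ringEquiv e.toRingEquiv
    ((stalkIdeal J x).map (algebraMap _ (Localization.AtPrime _))) μ).mpr hle
  rw [Ideal.map_map] at h1
  have hcomp : (e.toRingEquiv.toRingHom).comp
      (algebraMap (X.presheaf.stalk x) (Localization.AtPrime _)) =
        algebraMap (X.presheaf.stalk x) (X.presheaf.stalk ζ) := by
    ext r
    exact e.commutes r
  rw [RingEquiv.toRingHom_eq_coe] at hcomp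
  rwa [hcomp, hmap] at h1

end Literature.AlgebraicGeometry.Resolution

end
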